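import Summits.Ventures.PackingBounds.Configurations.SubspaceTransfer
import Summits.Ventures.PackingBounds.ThreePointCert.C7QProof
import Summits.Ventures.PackingBounds.ThreePointCert.C8QProof
import Summits.Ventures.PackingBounds.ThreePointCert.C9QProof
import Summits.Ventures.PackingBounds.ThreePointCert.C10QProof
import Summits.Ventures.PackingBounds.ThreePointCert.C4FProof
import Summits.Ventures.PackingBounds.SphericalCodes.Dim7N56
import Summits.Ventures.PackingBounds.SphericalCodes.Dim6N27
import Summits.Ventures.PackingBounds.SphericalCodes.Dim5N16
import Summits.Ventures.PackingBounds.SphericalCodes.DimFourElevenPoints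

/-!
# Spheres touching `k + 1` mutually touching spheres ↔ spherical codes of angle `arccos 1/(k+2)`

Framing: lottery ticket; floor = certified bounds/negative ranges. Venture `PackingBounds` (cell `pub-packcert`),
spherical-codes family; the reading layer for the standard-angle columns `s = 1/3, 1/4, 1/5, 1/6` (tables B2 / B2c).

Conway–Sloane, *SPLAG* Ch. 14, Theorem 1 ('whose proof is trivial'): in a packing of unit spheres of `ℝᵐ` let
`S₁, …, S_K` be mutually touching spheres; if further spheres `T₁, …, T_M` of the packing each touch all the `Sᵢ`, then after
rescaling the centres of the `Tⱼ` form an `(m - K + 1, M, 1/(K + 1))` spherical code. (Example 2 there: in `E₈`, `240` spheres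
touch each sphere, `56` each touching pair, `27` each mutually touching triple, and so on — the codes `(7, 56, 1/3)`,
`(6, 27, 1/4)`, `(5, 16, 1/5)`, `(4, 10, 1/6)`.)

This file proves Theorem 1 for every `m = n + k` and `K = k + 1` (`exists_code_of_touching`: the code lives in `ℝⁿ` and has
angle `arccos 1/(k+2)`; the proof is the centroid computation — the Gram matrix of `c - aᵢ` is `2(I + J)` — followed by the
cell's codimension-`k` transfer `Config.exists_transfer_orthogonal`), the resulting bound transfer
(`touching_le_of_code_bound`), and then reads kernel-checked cells of the cell's tables in that language:

* three mutually touching unit spheres (`s = 1/4`): at most `27 / 35 / 46 / 58 / 74` further unit spheres of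
  `ℝ⁸ / ℝ⁹ / ℝ¹⁰ / ℝ¹¹ / ℝ¹²` touch all three (LP-sharp `A(6, arccos 1/4) = 27`; three-point rows `C7Q`, `C8Q`, `C9Q`, `C10Q`);
* four mutually touching unit spheres (`s = 1/5`): at most `10` in `ℝ⁷` (three-point row `C4F`) and `16` in `ℝ⁸` (LP-sharp);
* five mutually touching unit spheres (`s = 1/6`): at most `10` in `ℝ⁸` (`S3T11` / Petersen code cell);
* the `E₈` chain of SPLAG's Example 2 as upper bounds in `ℝ⁸`: `56`, `27`, `16`, `10`.

The case `k = 1` (two touching spheres, `s = 1/3`, SPLAG Table 9.2) is `SphericalCodes/TouchingTwoSpheres.lean`.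
All statements use Mathlib notions only.

## References
* J. H. Conway, N. J. A. Sloane, *Sphere Packings, Lattices and Groups*, 3rd ed., Springer 1999, Ch. 14 Theorem 1 and
  Example 2. [`ConwaySloane1999`]
* C. Bachoc, F. Vallentin, New upper bounds for kissing numbers from semidefinite programming, J. Amer. Math. Soc. 21 (2008),
  Theorem 4.2. [`BachocVallentin2007`]
-/

noncomputable section

open Finset
open scoped RealInnerProductSpace

namespace Summit.Ventures.PackingBounds.SphericalCodes

/-! ## Elementary inner-product facts -/

/-- `‖x‖ = ‖y‖ = ‖y - x‖ = 2` ⇒ `⟪x, y⟫ = 2` (an equilateral triangle of side `2`). -/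
theorem inner_eq_two_of_norm_two {E : Type*} [NormedAddCommGroup E] [InnerProductSpace ℝ E] (x y : E)
    (hx : ‖x‖ = 2) (hy : ‖y‖ = 2) (hxy : ‖y - x‖ = 2) : inner ℝ x y = 2 := by
  have h1 : inner ℝ x x = 4 := by rw [real_inner_self_eq_norm_sq, hx]; norm_num
  have h2 : inner ℝ y y = 4 := by rw [real_inner_self_eq_norm_sq, hy]; norm_num
  have h3 : inner ℝ (y - x) (y - x) = 4 := by rw [real_inner_self_eq_norm_sq, hxy]; norm_num
  simp only [inner_sub_left, inner_sub_right] at h3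
  have hc := real_inner_comm x y
  linarith

/-- Gram matrix of the vectors `c - aᵢ` from a common toucher `c` to `k + 1` mutually touching centres: `4` on the diagonal,
`2` off the diagonal. -/
theorem inner_touch_gram {E : Type*} [NormedAddCommGroup E] [InnerProductSpace ℝ E] {ι : Type*} [DecidableEq ι]
    (a : ι → E)
    (ha : ∀ i j, i ≠ j → ‖a i - a j‖ = 2) (c : E) (hc : ∀ i, ‖c - a i‖ = 2) (i j : ι) :
    inner ℝ (c - a i) (c - a j) = if i = j then 4 else 2 := by
  split_ifs with h
  · subst h; rw [real_inner_self_eq_norm_sq, hc]; norm_num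
  · refine inner_eq_two_of_norm_two _ _ (hc i) (hc j) ?_
    rw [show c - a j - (c - a i) = a i - a j by abel]; exact ha i j h

/-! ## SPLAG Ch. 14 Theorem 1, for every `n` and `k` -/

/-- **SPLAG Ch. 14, Theorem 1** (touching spheres give spherical codes). Let `a₀, …, a_k` be the centres of `k + 1` mutually
touching unit spheres of `ℝⁿ⁺ᵏ` (`‖aᵢ - aⱼ‖ = 2`), and let `S` be a finite set of centres of unit spheres touching all of them
(`‖c - aᵢ‖ = 2`) with pairwise disjoint interiors (`‖c - c'‖ ≥ 2`). Then there is a code of `S.card` unit vectors in `ℝⁿ` with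
pairwise inner products `≤ 1/(k + 2)`. [cite: ConwaySloane1999, Ch. 14 Theorem 1] -/
theorem exists_code_of_touching {n k : ℕ} (a : Fin (k + 1) → EuclideanSpace ℝ (Fin (n + k)))
    (ha : ∀ i j, i ≠ j → ‖a i - a j‖ = 2) (S : Finset (EuclideanSpace ℝ (Fin (n + k))))
    (hS1 : ∀ c ∈ S, ∀ i, ‖c - a i‖ = 2) (hS2 : ∀ c ∈ S, ∀ c' ∈ S, c ≠ c' → 2 ≤ ‖c - c'‖) :
    ∃ C : Finset (EuclideanSpace ℝ (Fin n)), C.card = S.card ∧ (∀ x ∈ C, ‖x‖ = 1) ∧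
      (∀ x ∈ C, ∀ y ∈ C, x ≠ y → inner ℝ x y ≤ 1 / ((k : ℝ) + 2)) := by
  -- abbreviations
  set K : ℝ := (k : ℝ) + 1 with hK
  have hKpos : 0 < K := by rw [hK]; positivity
  have hcardK : ((Finset.univ : Finset (Fin (k + 1))).card : ℝ) = K := by
    rw [Finset.card_univ, Fintype.card_fin]; push_cast; rw [hK]
  -- the unnormalised centred vector W c = Σᵢ (c - aᵢ) = (k+1) • (c - centroid)
  set W : EuclideanSpace ℝ (Fin (n + k)) → EuclideanSpace ℝ (Fin (n + k)) := fun c => ∑ i, (c - a i) with hW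
  -- row sums of the Gram matrix
  have hrow : ∀ c ∈ S, ∀ i, ∑ j, inner ℝ (c - a i) (c - a j) = 2 * K + 2 := by
    intro c hc i
    have hg : ∀ j, inner ℝ (c - a i) (c - a j) = 2 + (if i = j then 2 else 0) := by
      intro j; rw [inner_touch_gram a ha c (hS1 c hc) i j]; split_ifs <;> norm_num
    simp_rw [hg]
    rw [Finset.sum_add_distrib, Finset.sum_const, Finset.sum_ite_eq, if_pos (Finset.mem_univ _), nsmul_eq_mul,
      hcardK]
    ring
  have hWW : ∀ c ∈ S, inner ℝ (W c) (W c) = K * (2 * K + 2) := by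
    intro c hc
    rw [hW]; simp only []
    rw [sum_inner]
    simp_rw [inner_sum]
    simp_rw [hrow c hc]
    rw [Finset.sum_const, nsmul_eq_mul, hcardK]
  have hWsub : ∀ c c' : EuclideanSpace ℝ (Fin (n + k)), W c - W c' = K • (c - c') := by
    intro c c'
    rw [hW]; simp only []
    rw [← Finset.sum_sub_distrib]
    have : ∀ i : Fin (k + 1), c - a i - (c' - a i) = c - c' := fun i => by abel
    simp_rw [this]
    rw [Finset.sum_const, ← Nat.cast_smul_eq_nsmul ℝ, Finset.card_univ, Fintype.card_fin]; push_cast; rw [hK]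
  have hWW' : ∀ c ∈ S, ∀ c' ∈ S, c ≠ c' → inner ℝ (W c) (W c') ≤ K * (2 * K + 2) - 2 * K ^ 2 := by
    intro c hc c' hc' hne
    obtain ⟨D, hD⟩ : ∃ D : ℝ, inner ℝ (c - c') (c - c') = D := ⟨_, rfl⟩
    have hd : (4 : ℝ) ≤ D := by
      rw [← hD, real_inner_self_eq_norm_sq]
      have := hS2 c hc c' hc' hne
      nlinarith [norm_nonneg (c - c')]
    have hsub : inner ℝ (W c - W c') (W c - W c') = K ^ 2 * D := by
      rw [hWsub, real_inner_smul_left, real_inner_smul_right, hD]; ring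
    simp only [inner_sub_left, inner_sub_right] at hsub
    have hc1 := hWW c hc
    have hc2 := hWW c' hc'
    have hcomm := real_inner_comm (W c) (W c')
    have hKD : K ^ 2 * 4 ≤ K ^ 2 * D := mul_le_mul_of_nonneg_left hd (sq_nonneg K)
    linarith
  -- orthogonality to the simplex directions aᵢ₊₁ - a₀
  set u : Fin k → EuclideanSpace ℝ (Fin (n + k)) := fun i => a i.succ - a 0 with hu
  have hWu : ∀ c ∈ S, ∀ i : Fin k, inner ℝ (u i) (W c) = 0 := by
    intro c hc i
    have e : u i = (c - a 0) - (c - a i.succ) := by rw [hu]; simp only []; abel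
    rw [e, hW]; simp only []
    rw [inner_sub_left, inner_sum, inner_sum, hrow c hc 0, hrow c hc i.succ, sub_self]
  -- the simplex directions are linearly independent (Gram matrix 2(I + J) is positive definite)
  have hug : ∀ i j : Fin k, inner ℝ (u i) (u j) = if i = j then 4 else 2 := by
    intro i j
    split_ifs with h
    · subst h; rw [real_inner_self_eq_norm_sq, hu]; simp only []
      rw [ha _ _ (Fin.succ_ne_zero i)]; norm_num
    · refine inner_eq_two_of_norm_two _ _ ?_ ?_ ?_
      · rw [hu]; simp only []; exact ha _ _ (Fin.succ_ne_zero i)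
      · rw [hu]; simp only []; exact ha _ _ (Fin.succ_ne_zero j)
      · rw [hu]; simp only []
        rw [show a j.succ - a 0 - (a i.succ - a 0) = a j.succ - a i.succ by abel]
        exact ha _ _ (fun h' => h (Fin.succ_injective _ h').symm)
  have hli : LinearIndependent ℝ u := by
    rw [Fintype.linearIndependent_iff]
    intro g hg i
    have h0 : inner ℝ (∑ i, g i • u i) (∑ j, g j • u j) = 0 := by rw [hg, inner_zero_left]
    rw [sum_inner] at h0
    simp_rw [inner_sum, real_inner_smul_left, real_inner_smul_right, hug] at h0
    have hsplit : ∀ i' : Fin k, ∑ j, g i' * (g j * (if i' = j then (4 : ℝ) else 2)) =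
        2 * (g i' * ∑ j, g j) + 2 * g i' ^ 2 := by
      intro i'
      have : ∀ j, g i' * (g j * (if i' = j then (4 : ℝ) else 2)) =
          2 * (g i' * g j) + (if i' = j then 2 * g i' ^ 2 else 0) := by
        intro j; split_ifs with h
        · subst h; ring
        · ring
      simp_rw [this]
      rw [Finset.sum_add_distrib, Finset.sum_ite_eq, if_pos (Finset.mem_univ _), ← Finset.mul_sum, ← Finset.mul_sum]
    simp_rw [hsplit] at h0
    rw [Finset.sum_add_distrib, ← Finset.mul_sum, ← Finset.mul_sum, ← Finset.sum_mul] at h0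
    have hsq : (∑ j, g j) * ∑ j, g j = (∑ j, g j) ^ 2 := by ring
    rw [hsq] at h0
    have hnn1 : (0 : ℝ) ≤ (∑ j, g j) ^ 2 := sq_nonneg _
    have hnn2 : (0 : ℝ) ≤ ∑ j, g j ^ 2 := Finset.sum_nonneg fun j _ => sq_nonneg _
    have hz : ∑ j, g j ^ 2 = 0 := by linarith
    have := (Finset.sum_eq_zero_iff_of_nonneg (fun j _ => sq_nonneg (g j))).mp hz i (Finset.mem_univ _)
    exact pow_eq_zero_iff (two_ne_zero) |>.mp this
  -- the normalised code in ℝⁿ⁺ᵏ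
  set ρ : ℝ := Real.sqrt (K * (2 * K + 2)) with hρ
  have hρpos : 0 < ρ := by rw [hρ]; exact Real.sqrt_pos.mpr (by positivity)
  have hρsq : ρ * ρ = K * (2 * K + 2) := by rw [hρ]; exact Real.mul_self_sqrt (by positivity)
  set f : EuclideanSpace ℝ (Fin (n + k)) → EuclideanSpace ℝ (Fin (n + k)) := fun c => (1 / ρ) • W c with hf
  have hfn : ∀ c ∈ S, ‖f c‖ = 1 := by
    intro c hc
    have hn : ‖W c‖ = ρ := by
      rw [← Real.sqrt_sq (norm_nonneg (W c)), ← real_inner_self_eq_norm_sq, hWW c hc, hρ]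
    rw [hf]; simp only []
    rw [norm_smul, hn, Real.norm_eq_abs, abs_of_pos (by positivity)]
    field_simp
  have hfi : ∀ c ∈ S, ∀ c' ∈ S, c ≠ c' → inner ℝ (f c) (f c') ≤ 1 / ((k : ℝ) + 2) := by
    intro c hc c' hc' hne
    rw [hf]; simp only []
    rw [real_inner_smul_left, real_inner_smul_right, ← mul_assoc,
      show (1 / ρ) * (1 / ρ) = 1 / (K * (2 * K + 2)) by rw [div_mul_div_comm, one_mul, hρsq]]
    have hb := hWW' c hc c' hc' hne
    rw [div_mul_eq_mul_div, one_mul, div_le_div_iff₀ (by positivity) (by positivity), one_mul]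
    have : (K * (2 * K + 2) - 2 * K ^ 2) * ((k : ℝ) + 2) = K * (2 * K + 2) := by rw [hK]; ring
    nlinarith [hKpos, this]
  have hfo : ∀ x ∈ S.image f, ∀ i, inner ℝ (u i) x = 0 := by
    intro x hx i
    obtain ⟨c, hc, rfl⟩ := mem_image.mp hx
    rw [hf]; simp only []
    rw [real_inner_smul_right, hWu c hc i, mul_zero]
  have hinj : Set.InjOn f S := by
    intro c hc c' hc' he
    by_contra hne
    have h := hfi c hc c' hc' hne
    rw [he, real_inner_self_eq_norm_sq, hfn c' hc'] at h
    have : (1 : ℝ) / ((k : ℝ) + 2) < 1 := by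
      rw [div_lt_one (by positivity)]; linarith [(Nat.cast_nonneg k : (0 : ℝ) ≤ k)]
    rw [one_pow] at h; linarith
  -- transfer to ℝⁿ
  obtain ⟨C', hcard, hno, hin, -⟩ :=
    Config.exists_transfer_orthogonal (m := n + k) (n := n) (k := k) rfl u hli (S.image f) hfo
  refine ⟨C', by rw [hcard, card_image_of_injOn hinj], ?_, ?_⟩
  · intro x hx
    obtain ⟨y, hy, he⟩ := hno x hx
    obtain ⟨c, hc, rfl⟩ := mem_image.mp hy
    rw [he]; exact hfn c hc
  · intro x hx y hy hne
    obtain ⟨x0, hx0, y0, hy0, hne0, he⟩ := hin x hx y hy hne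
    obtain ⟨c, hc, rfl⟩ := mem_image.mp hx0
    obtain ⟨c', hc', rfl⟩ := mem_image.mp hy0
    rw [he]
    exact hfi c hc c' hc' (fun h => hne0 (by rw [h]))

/-- **Bound transfer** (SPLAG Ch. 14 Thm 1 ⇒ counting): if every code of unit vectors of `ℝⁿ` with pairwise inner products
`≤ 1/(k+2)` has at most `N` points, then at most `N` unit spheres of `ℝⁿ⁺ᵏ` with pairwise disjoint interiors can touch `k + 1`
given mutually touching unit spheres. [cite: ConwaySloane1999, Ch. 14 Theorem 1] -/
theorem touching_le_of_code_bound {n k N : ℕ}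
    (hN : ∀ C : Finset (EuclideanSpace ℝ (Fin n)), (∀ x ∈ C, ‖x‖ = 1) →
      (∀ x ∈ C, ∀ y ∈ C, x ≠ y → inner ℝ x y ≤ 1 / ((k : ℝ) + 2)) → C.card ≤ N)
    (a : Fin (k + 1) → EuclideanSpace ℝ (Fin (n + k))) (ha : ∀ i j, i ≠ j → ‖a i - a j‖ = 2)
    (S : Finset (EuclideanSpace ℝ (Fin (n + k))))
    (hS1 : ∀ c ∈ S, ∀ i, ‖c - a i‖ = 2) (hS2 : ∀ c ∈ S, ∀ c' ∈ S, c ≠ c' → 2 ≤ ‖c - c'‖) :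
    S.card ≤ N := by
  obtain ⟨C, hC, h1, h2⟩ := exists_code_of_touching a ha S hS1 hS2
  rw [← hC]; exact hN C h1 h2

/-! ## Rows: three mutually touching spheres (`s = 1/4`) -/

/-- **`ℝ⁸`, three mutually touching unit spheres: at most `27`** further non-overlapping unit spheres touch all three
(kernel: the LP-sharp bound `A(6, arccos 1/4) ≤ 27`, `code_dim6_le_27`; attained in `E₈`, SPLAG Ch. 14 Example 2).
[cite: ConwaySloane1999, Ch. 14 Example 2] -/
theorem touching_three_dim8_le_27 (a : Fin 3 → EuclideanSpace ℝ (Fin 8)) (ha : ∀ i j, i ≠ j → ‖a i - a j‖ = 2)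
    (S : Finset (EuclideanSpace ℝ (Fin 8))) (hS1 : ∀ c ∈ S, ∀ i, ‖c - a i‖ = 2)
    (hS2 : ∀ c ∈ S, ∀ c' ∈ S, c ≠ c' → 2 ≤ ‖c - c'‖) : S.card ≤ 27 :=
  touching_le_of_code_bound (n := 6) (k := 2) (fun C h1 h2 => code_dim6_le_27 C h1
    (fun x hx y hy hxy => (h2 x hx y hy hxy).trans_eq (by norm_num))) a ha S hS1 hS2

/-- **`ℝ⁹`, three mutually touching unit spheres: at most `35`** (kernel three-point row `C7Q`: `A(7, arccos 1/4) ≤ 35`).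
[cite: BachocVallentin2007, Theorem 4.2] -/
theorem touching_three_dim9_le_35 (a : Fin 3 → EuclideanSpace ℝ (Fin 9)) (ha : ∀ i j, i ≠ j → ‖a i - a j‖ = 2)
    (S : Finset (EuclideanSpace ℝ (Fin 9))) (hS1 : ∀ c ∈ S, ∀ i, ‖c - a i‖ = 2)
    (hS2 : ∀ c ∈ S, ∀ c' ∈ S, c ≠ c' → 2 ≤ ‖c - c'‖) : S.card ≤ 35 :=
  touching_le_of_code_bound (n := 7) (k := 2) (fun C h1 h2 => ThreePointCert.C7Q.code_dim7_quarter_le_35_sdp C h1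
    (fun x hx y hy hxy => (h2 x hx y hy hxy).trans_eq (by norm_num))) a ha S hS1 hS2

/-- **`ℝ¹⁰`, three mutually touching unit spheres: at most `46`** (kernel three-point row `C8Q`: `A(8, arccos 1/4) ≤ 46`).
[cite: BachocVallentin2007, Theorem 4.2] -/
theorem touching_three_dim10_le_46 (a : Fin 3 → EuclideanSpace ℝ (Fin 10)) (ha : ∀ i j, i ≠ j → ‖a i - a j‖ = 2)
    (S : Finset (EuclideanSpace ℝ (Fin 10))) (hS1 : ∀ c ∈ S, ∀ i, ‖c - a i‖ = 2)
    (hS2 : ∀ c ∈ S, ∀ c' ∈ S, c ≠ c' → 2 ≤ ‖c - c'‖) : S.card ≤ 46 :=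
  touching_le_of_code_bound (n := 8) (k := 2) (fun C h1 h2 => ThreePointCert.C8Q.code_dim8_quarter_le_46_sdp C h1
    (fun x hx y hy hxy => (h2 x hx y hy hxy).trans_eq (by norm_num))) a ha S hS1 hS2

/-- **`ℝ¹¹`, three mutually touching unit spheres: at most `58`** (kernel three-point row `C9Q`: `A(9, arccos 1/4) ≤ 58`).
[cite: BachocVallentin2007, Theorem 4.2] -/
theorem touching_three_dim11_le_58 (a : Fin 3 → EuclideanSpace ℝ (Fin 11)) (ha : ∀ i j, i ≠ j → ‖a i - a j‖ = 2)
    (S : Finset (EuclideanSpace ℝ (Fin 11))) (hS1 : ∀ c ∈ S, ∀ i, ‖c - a i‖ = 2)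
    (hS2 : ∀ c ∈ S, ∀ c' ∈ S, c ≠ c' → 2 ≤ ‖c - c'‖) : S.card ≤ 58 :=
  touching_le_of_code_bound (n := 9) (k := 2) (fun C h1 h2 => ThreePointCert.C9Q.code_dim9_quarter_le_58_sdp C h1
    (fun x hx y hy hxy => (h2 x hx y hy hxy).trans_eq (by norm_num))) a ha S hS1 hS2

/-- **`ℝ¹²`, three mutually touching unit spheres: at most `74`** (kernel three-point row `C10Q`: `A(10, arccos 1/4) ≤ 74`).
[cite: BachocVallentin2007, Theorem 4.2] -/
theorem touching_three_dim12_le_74 (a : Fin 3 → EuclideanSpace ℝ (Fin 12)) (ha : ∀ i j, i ≠ j → ‖a i - a j‖ = 2)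
    (S : Finset (EuclideanSpace ℝ (Fin 12))) (hS1 : ∀ c ∈ S, ∀ i, ‖c - a i‖ = 2)
    (hS2 : ∀ c ∈ S, ∀ c' ∈ S, c ≠ c' → 2 ≤ ‖c - c'‖) : S.card ≤ 74 :=
  touching_le_of_code_bound (n := 10) (k := 2) (fun C h1 h2 => ThreePointCert.C10Q.code_dim10_quarter_le_74_sdp C h1
    (fun x hx y hy hxy => (h2 x hx y hy hxy).trans_eq (by norm_num))) a ha S hS1 hS2

/-! ## Rows: four and five mutually touching spheres (`s = 1/5`, `s = 1/6`) -/

/-- **`ℝ⁷`, four mutually touching unit spheres: at most `10`** further non-overlapping unit spheres touch all four (kernel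
three-point row `C4F`: `A(4, arccos 1/5) ≤ 10`; the Petersen code attains `10`). [cite: BachocVallentin2007, Theorem 4.2] -/
theorem touching_four_dim7_le_10 (a : Fin 4 → EuclideanSpace ℝ (Fin 7)) (ha : ∀ i j, i ≠ j → ‖a i - a j‖ = 2)
    (S : Finset (EuclideanSpace ℝ (Fin 7))) (hS1 : ∀ c ∈ S, ∀ i, ‖c - a i‖ = 2)
    (hS2 : ∀ c ∈ S, ∀ c' ∈ S, c ≠ c' → 2 ≤ ‖c - c'‖) : S.card ≤ 10 :=
  touching_le_of_code_bound (n := 4) (k := 3) (fun C h1 h2 => ThreePointCert.C4F.code_dim4_fifth_le_10_sdp C h1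
    (fun x hx y hy hxy => (h2 x hx y hy hxy).trans_eq (by norm_num))) a ha S hS1 hS2

/-- **`ℝ⁸`, four mutually touching unit spheres: at most `16`** (kernel: the LP-sharp bound `A(5, arccos 1/5) ≤ 16`,
`code_dim5_le_16`; attained in `E₈`). [cite: ConwaySloane1999, Ch. 14 Example 2] -/
theorem touching_four_dim8_le_16 (a : Fin 4 → EuclideanSpace ℝ (Fin 8)) (ha : ∀ i j, i ≠ j → ‖a i - a j‖ = 2)
    (S : Finset (EuclideanSpace ℝ (Fin 8))) (hS1 : ∀ c ∈ S, ∀ i, ‖c - a i‖ = 2)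
    (hS2 : ∀ c ∈ S, ∀ c' ∈ S, c ≠ c' → 2 ≤ ‖c - c'‖) : S.card ≤ 16 :=
  touching_le_of_code_bound (n := 5) (k := 3) (fun C h1 h2 => code_dim5_le_16 C h1
    (fun x hx y hy hxy => (h2 x hx y hy hxy).trans_eq (by norm_num))) a ha S hS1 hS2

/-- **`ℝ⁸`, five mutually touching unit spheres: at most `10`** (kernel: `A(4, arccos 1/6) ≤ 10` from the three-point row
`S3T11` through `code_dim4_eq_10_of_mem_Icc_83_400`; attained in `E₈`). [cite: ConwaySloane1999, Ch. 14 Example 2] -/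
theorem touching_five_dim8_le_10 (a : Fin 5 → EuclideanSpace ℝ (Fin 8)) (ha : ∀ i j, i ≠ j → ‖a i - a j‖ = 2)
    (S : Finset (EuclideanSpace ℝ (Fin 8))) (hS1 : ∀ c ∈ S, ∀ i, ‖c - a i‖ = 2)
    (hS2 : ∀ c ∈ S, ∀ c' ∈ S, c ≠ c' → 2 ≤ ‖c - c'‖) : S.card ≤ 10 :=
  touching_le_of_code_bound (n := 4) (k := 4)
    (fun C h1 h2 => (code_dim4_eq_10_of_mem_Icc_83_400 (s := 1 / 6) le_rfl (by norm_num)).2 C h1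
      (fun x hx y hy hxy => (h2 x hx y hy hxy).trans_eq (by norm_num))) a ha S hS1 hS2

/-- **`ℝ⁸`, two touching unit spheres: at most `56`** further non-overlapping unit spheres touch both (kernel: the LP-sharp
bound `A(7, arccos 1/3) ≤ 56`, `code_dim7_le_56`; attained in `E₈`) — the `k = 1` instance of Theorem 1, for comparison with
`SphericalCodes/TouchingTwoSpheres.lean`. [cite: ConwaySloane1999, Ch. 14 Example 2] -/
theorem touching_two_dim8_le_56 (a : Fin 2 → EuclideanSpace ℝ (Fin 8)) (ha : ∀ i j, i ≠ j → ‖a i - a j‖ = 2)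
    (S : Finset (EuclideanSpace ℝ (Fin 8))) (hS1 : ∀ c ∈ S, ∀ i, ‖c - a i‖ = 2)
    (hS2 : ∀ c ∈ S, ∀ c' ∈ S, c ≠ c' → 2 ≤ ‖c - c'‖) : S.card ≤ 56 :=
  touching_le_of_code_bound (n := 7) (k := 1) (fun C h1 h2 => code_dim7_le_56 C h1
    (fun x hx y hy hxy => (h2 x hx y hy hxy).trans_eq (by norm_num))) a ha S hS1 hS2

end Summit.Ventures.PackingBounds.SphericalCodes
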